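import Summits.NavierStokesRegularity.FluidComputer.PalasekTowerStrainHybridShadowedRunParam

/-!
# THE STRAIN-SHADOWED RUN, HYBRID CURRENCY (route (A′)) — II: EXISTENCE on `[0, T]`

Cell `ns-blowup`, seat `ns-blowup-fc-prover-2` (g10); companion of `PalasekTowerStrainHybridShadowedRun.lean` (the
a-priori half `StrainShadowHybrid.freeRun_near_of_strainHybrid`). LABEL: E–C typing + kernel analysis (theorems only;
no definition, no named fact, no `sorry`). WHAT THIS IS NOT: not Navier–Stokes evidence — existence-and-closeness of a
free run next to a GIVEN forced reference on a FIXED slab under explicit real inequalities; nothing is exhibited.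

* `exists_freeRun_near_of_strainHybrid` — under the hypotheses of the a-priori half plus `div U = 0` and a speed bound
  `‖w‖ ≤ B_w` of the reference, the free classical finite-energy run `v` from `v(0) = U` EXISTS on `[0, T] × ℝ³` and
  `‖v − w‖ ≤ δ` there (every free run on a sub-slab is bounded by `B_w + δ`;
  `ClayEvolution.exists_classical_Icc_of_apriori_bound`) — the shape `StrainDoor.episodeBaseGAt_of_mechanismDoorAt_of_nearFreeRun`
  (p530553) consumes, exactly as for route (B) (`StrainShadowH2.exists_freeRun_near_of_strainH2`, p536175).

References: [cite: RobinsonRodrigoSadowskiCUP2016, Thm 9.1 and Thm 1.20]; [cite: DashtiRobinson2008, Thm 1, Thm 2];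
[cite: ConstantinFoias1988, Ch. 10]; [cite: Tao2011, Thm. 5.4 (ii)+(iv)]; [cite: FeffermanClay2006, (4)–(6)].
-/

noncomputable section

namespace Summit.NavierStokesRegularity.FluidComputer.PalasekTowerClayBridge.StrainShadowHybrid

open Set MeasureTheory Filter Topology Function InnerProductSpace
open scoped ENNReal NNReal ContDiff RealInnerProductSpace
open Literature.Analysis Literature.Analysis.FluidPDE

/-- A smooth compactly supported field on `ℝ³` is rapidly decaying (Fefferman's (4)).
[cite: FeffermanClay2006, (4)] -/
private theorem hasRapidSpatialDecay_of_hasCompactSupport'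
    {φ : EuclideanSpace ℝ (Fin 3) → EuclideanSpace ℝ (Fin 3)} (hsm : ContDiff ℝ ∞ φ)
    (hc : HasCompactSupport φ) : HasRapidSpatialDecay φ := by
  intro n K
  have hcont : Continuous fun x => (1 + ‖x‖) ^ K * ‖iteratedFDeriv ℝ n φ x‖ :=
    ((continuous_const.add continuous_norm).pow K).mul
      (hsm.continuous_iteratedFDeriv (m := n) (mod_cast le_top)).norm
  have hsupp : HasCompactSupport fun x => (1 + ‖x‖) ^ K * ‖iteratedFDeriv ℝ n φ x‖ :=
    ((hc.iteratedFDeriv n).norm).mul_left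
  obtain ⟨C, hC⟩ := hcont.bounded_above_of_compact_support hsupp
  exact ⟨C, fun x => by have h := hC x; rwa [Real.norm_eq_abs, abs_of_nonneg (by positivity)] at h⟩

section Main


variable {T Bw E₀ κ μ D₁ Ψ₁ D₂ Ψ₂ δ τw : ℝ}
  {w r : ℝ → EuclideanSpace ℝ (Fin 3) → EuclideanSpace ℝ (Fin 3)}
  {ϖ : ℝ → EuclideanSpace ℝ (Fin 3) → ℝ} {G σ₂ σ₃ Rr L H₁ ψ₁ ψ₂ X₁ Dτ Ψτ : ℝ → ℝ}
  {U : EuclideanSpace ℝ (Fin 3) → EuclideanSpace ℝ (Fin 3)}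

/-- The zero force is smooth on the closed half-space. [cite: FeffermanClay2006, (5) (6)] -/
private theorem isSmoothOnHalfSpace_zero_force :
    IsSmoothOnHalfSpace (0 : ℝ → EuclideanSpace ℝ (Fin 3) → EuclideanSpace ℝ (Fin 3)) := by
  have h : uncurry (0 : ℝ → EuclideanSpace ℝ (Fin 3) → EuclideanSpace ℝ (Fin 3)) = fun _ => 0 := by
    funext q; rfl
  rw [IsSmoothOnHalfSpace, h]
  exact contDiffOn_const

/-- The zero force has Fefferman's space-time decay (5). [cite: FeffermanClay2006, (5) (6)] -/
private theorem hasRapidSpaceTimeDecay_zero_force :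
    HasRapidSpaceTimeDecay (0 : ℝ → EuclideanSpace ℝ (Fin 3) → EuclideanSpace ℝ (Fin 3)) := by
  intro n K
  have h : uncurry (0 : ℝ → EuclideanSpace ℝ (Fin 3) → EuclideanSpace ℝ (Fin 3)) = 0 := by
    funext q; rfl
  refine ⟨0, fun t _ x => ?_⟩
  rw [h, iteratedFDerivWithin_zero]
  simp

/-- **THE STRAIN-SHADOWED RUN, HYBRID CURRENCY (existence and sup-closeness).** Under the hypotheses of
`freeRun_near_of_strainHybrid` plus divergence-freeness of the datum and a speed bound `‖w‖ ≤ B_w` of the reference, the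
free classical finite-energy run `v` from `v(0) = U` EXISTS on `[0, T] × ℝ³` and `‖v − w‖ ≤ δ` there (every free run
on a sub-slab is bounded by `B_w + δ` by the a-priori half; `ClayEvolution.exists_classical_Icc_of_apriori_bound`).
[cite: RobinsonRodrigoSadowskiCUP2016, Thm 9.1 and Thm 1.20] [cite: DashtiRobinson2008, Thm 1, Thm 2]
[cite: ConstantinFoias1988, Ch. 10] [cite: Tao2011, Thm. 5.4 (ii)+(iv)] -/
theorem exists_freeRun_near_of_strainHybrid_of_agmonBound {A : ℝ} (hAg : AgmonBoundR3 A) (hT : 0 < T) (hτw : 0 < τw) (hτwT : τw ≤ T)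
    (hw : IsClassicalNSSolutionOn (Icc 0 T) 1 r w ϖ)
    (hwS : HasBoundedSobolevNormsOn (Icc 0 T) w)
    (hwt : HasBoundedSobolevNormsOn (Icc 0 T) (FluidPDE.timeDerivWithin (Icc 0 T) w))
    (hϖS : ∀ n : ℕ, ∃ C' : ℝ≥0, ∀ t ∈ Icc 0 T, ∫⁻ x, ‖iteratedFDeriv ℝ n (ϖ t) x‖ₑ ^ 2 ≤ C')
    (hrL2 : ∀ t ∈ Icc 0 T, ∫⁻ x, ‖r t x‖ₑ ^ 2 < ⊤)
    (hrD : ∀ t ∈ Icc 0 T, ∫⁻ x, ‖fderiv ℝ (r t) x‖ₑ ^ 2 < ⊤)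
    (hbw : ∀ t ∈ Icc 0 T, ∀ y, ‖w t y‖ ≤ Bw)
    (hκ : 0 < κ) (hμ : 0 < μ)
    (hG : ∀ s ∈ Icc 0 T, ∀ (x ξ : EuclideanSpace ℝ (Fin 3)), -⟪fderiv ℝ (w s) x ξ, ξ⟫ ≤ G s * ‖ξ‖ ^ 2)
    (hG0 : ∀ s ∈ Icc 0 T, 0 ≤ G s)
    (hσ₂ : ∀ s ∈ Icc 0 T, ∀ x, ‖iteratedFDeriv ℝ 2 (w s) x‖ ≤ σ₂ s)
    (hσ₃ : ∀ s ∈ Icc 0 T, ∀ x, ‖iteratedFDeriv ℝ 3 (w s) x‖ ≤ σ₃ s)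
    (hRr0 : ∀ s ∈ Icc 0 T, 0 ≤ Rr s) (hRr : ∀ s ∈ Icc 0 T, ∫ x, ‖r s x‖ ^ 2 ≤ Rr s ^ 2)
    (hLdef : ∀ s ∈ Icc 0 T, (E₀ + ∫ τ in (0 : ℝ)..s, Rr τ) * Real.exp (∫ τ in (0 : ℝ)..s, G τ) ≤ L s)
    (hH₁ : ∀ s ∈ Icc 0 T, ∫ x, ‖fderiv ℝ (fun y => r s y - (0 : EuclideanSpace ℝ (Fin 3))) x‖ ^ 2 ≤ H₁ s)
    (hψ₁ : ∀ s ∈ Icc 0 T, 2 / 1 * (∫ x, ‖r s x - (0 : EuclideanSpace ℝ (Fin 3))‖ ^ 2) +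
      3 * σ₂ s / κ * L s ^ 2 ≤ ψ₁ s)
    (hψ₂ : ∀ s ∈ Icc 0 T, 27 * σ₂ s / κ * X₁ s + 9 * σ₃ s / κ ^ 2 * L s ^ 2 + 6 / 1 * H₁ s ≤ ψ₂ s)
    (hGc : ContinuousOn G (Icc 0 T)) (hσ₂c : ContinuousOn σ₂ (Icc 0 T)) (hσ₃c : ContinuousOn σ₃ (Icc 0 T))
    (hRrc : ContinuousOn Rr (Icc 0 T)) (hLc : ContinuousOn L (Icc 0 T)) (hX₁c : ContinuousOn X₁ (Icc 0 T))
    (hH₁c : ContinuousOn H₁ (Icc 0 T)) (hψ₁c : ContinuousOn ψ₁ (Icc 0 T)) (hψ₂c : ContinuousOn ψ₂ (Icc 0 T))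
    (hU : ContDiff ℝ ∞ U) (hUc : HasCompactSupport U) (hUdiv : VectorCalculus.IsDivFree U)
    (hE₀ : 0 ≤ E₀) (hE0 : ∫ x, ‖U x - w 0 x‖ ^ 2 ≤ E₀ ^ 2)
    (hD₁ : ∫ x, frobeniusNormSq (fderiv ℝ (fun y => U y - w 0 y) x) ≤ D₁)
    (hD₂ : (∑ i, ∫ x, frobeniusNormSq (fderiv ℝ (fun y => fderiv ℝ (fun z => U z - w 0 z) y
      (EuclideanSpace.basisFun (Fin 3) ℝ i)) x)) ≤ D₂)
    (hΨ₁ : ∫ s in (0 : ℝ)..T, ψ₁ s ≤ Ψ₁) (hΨ₂ : ∫ s in (0 : ℝ)..τw, ψ₂ s ≤ Ψ₂)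
    (hhalf₁ : 2 * (A ^ 4 / (2 * (1 : ℝ) ^ 3) *
        Real.exp (2 * ∫ s in (0 : ℝ)..T, (4 * G s + 3 * κ * σ₂ s))) * (D₁ + Ψ₁) ^ 2 * (T - 0) ≤ 1 / 2)
    (hX₁ : ∀ s ∈ Icc 0 T,
      Real.sqrt 2 * (Real.exp (∫ τ in (0 : ℝ)..s, (4 * G τ + 3 * κ * σ₂ τ)) * (D₁ + Ψ₁)) ≤ X₁ s)
    (hhalf₂ : A ^ 2 * μ / 1 *
        Real.exp (∫ s in (0 : ℝ)..τw, (6 * G s + 9 * κ * σ₂ s + 3 * κ ^ 2 * σ₃ s +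
          3 * A ^ 2 * X₁ s / (1 * μ) + 27 * A ^ 4 * X₁ s ^ 2 / (16 * (1 : ℝ) ^ 3))) *
      (D₂ + Ψ₂) * (τw - 0) ≤ 1 / 2)
    (hδ₁ : ∀ t ∈ Icc 0 τw, A * (3 * X₁ t *
      (2 * (Real.exp (∫ s in (0 : ℝ)..t, (6 * G s + 9 * κ * σ₂ s + 3 * κ ^ 2 * σ₃ s +
          3 * A ^ 2 * X₁ s / (1 * μ) + 27 * A ^ 4 * X₁ s ^ 2 / (16 * (1 : ℝ) ^ 3))) *
        (D₂ + Ψ₂)))) ^ (1 / 4 : ℝ) ≤ δ)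
    (hDτ : ∀ t ∈ Icc τw T, X₁ (t - τw) + ∫ s in (t - τw)..t, ((4 * G s + 3 * κ * σ₂ s) * X₁ s +
        4 * A ^ 4 * X₁ s ^ 3 / (1 : ℝ) ^ 3 + 4 / 1 * Rr s ^ 2 + 3 * σ₂ s / κ * L s ^ 2) ≤ Dτ t)
    (hΨτ : ∀ t ∈ Icc τw T, ∫ s in (t - τw)..t, ψ₂ s ≤ Ψτ t)
    (hhalf₃ : ∀ t ∈ Icc τw T, A ^ 2 * μ / 1 *
        Real.exp (∫ s in (t - τw)..t, (6 * G s + 9 * κ * σ₂ s + 3 * κ ^ 2 * σ₃ s +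
          3 * A ^ 2 * X₁ s / (1 * μ) + 27 * A ^ 4 * X₁ s ^ 2 / (16 * (1 : ℝ) ^ 3))) *
      (2 * Dτ t / (1 * τw) + Ψτ t) * τw ≤ 1 / 2)
    (hδ₂ : ∀ t ∈ Icc τw T, A * (3 * X₁ t *
      (2 * Real.exp (∫ s in (t - τw)..t, (6 * G s + 9 * κ * σ₂ s + 3 * κ ^ 2 * σ₃ s +
          3 * A ^ 2 * X₁ s / (1 * μ) + 27 * A ^ 4 * X₁ s ^ 2 / (16 * (1 : ℝ) ^ 3))) *
        (2 * Dτ t / (1 * τw) + Ψτ t))) ^ (1 / 4 : ℝ) ≤ δ) :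
    ∃ (v : ℝ → EuclideanSpace ℝ (Fin 3) → EuclideanSpace ℝ (Fin 3))
      (q : ℝ → EuclideanSpace ℝ (Fin 3) → ℝ),
      IsClassicalNSSolutionOn (Icc 0 T) 1 0 v q ∧ v 0 = U ∧
      (∃ C : ℝ≥0∞, C < ⊤ ∧ ∀ t ∈ Icc 0 T, ∫⁻ x, ‖v t x‖ₑ ^ 2 ≤ C) ∧
      ∀ t ∈ Icc 0 T, ∀ x, ‖v t x - w t x‖ ≤ δ := by
  have hdec : HasRapidSpatialDecay U := hasRapidSpatialDecay_of_hasCompactSupport' hU hUc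
  have hapriori : ∀ T' ∈ Ioc 0 T,
      ∀ (u : ℝ → EuclideanSpace ℝ (Fin 3) → EuclideanSpace ℝ (Fin 3))
        (p : ℝ → EuclideanSpace ℝ (Fin 3) → ℝ),
        IsClassicalNSSolutionOn (Icc 0 T') 1 0 u p → u 0 = U →
        (∃ C : ℝ≥0∞, C < ⊤ ∧ ∀ t ∈ Icc 0 T', ∫⁻ x, ‖u t x‖ₑ ^ 2 ≤ C) →
        ∀ t ∈ Icc 0 T', ∀ x, ‖u t x‖ ≤ Bw + δ := by
    intro T' hT' u p hcl h0 hE t ht x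
    have hnear := freeRun_near_of_strainHybrid_of_agmonBound hAg hT hτw hτwT hw hwS hwt hϖS hrL2 hrD hκ hμ hG hG0 hσ₂ hσ₃ hRr0 hRr
      hLdef hH₁ hψ₁ hψ₂ hGc hσ₂c hσ₃c hRrc hLc hX₁c hH₁c hψ₁c hψ₂c hU hUc hE₀ hE0 hD₁ hD₂ hΨ₁ hΨ₂ hhalf₁ hX₁
      hhalf₂ hδ₁ hDτ hΨτ hhalf₃ hδ₂ hT'.1 hT'.2 hcl h0 hE t ht x
    have hwb := hbw t ⟨ht.1, ht.2.trans hT'.2⟩ x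
    calc ‖u t x‖ = ‖w t x + (u t x - w t x)‖ := by rw [add_sub_cancel]
      _ ≤ ‖w t x‖ + ‖u t x - w t x‖ := norm_add_le _ _
      _ ≤ Bw + δ := add_le_add hwb hnear
  obtain ⟨v, q, hcl, hv0, hEv, -⟩ :=
    ClayEvolution.exists_classical_Icc_of_apriori_bound one_pos hU (fun x => hUdiv x) hdec
      isSmoothOnHalfSpace_zero_force hasRapidSpaceTimeDecay_zero_force hT hapriori
  exact ⟨v, q, hcl, hv0, hEv, fun t ht x =>
    freeRun_near_of_strainHybrid_of_agmonBound hAg hT hτw hτwT hw hwS hwt hϖS hrL2 hrD hκ hμ hG hG0 hσ₂ hσ₃ hRr0 hRr hLdef hH₁ hψ₁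
      hψ₂ hGc hσ₂c hσ₃c hRrc hLc hX₁c hH₁c hψ₁c hψ₂c hU hUc hE₀ hE0 hD₁ hD₂ hΨ₁ hΨ₂ hhalf₁ hX₁ hhalf₂ hδ₁ hDτ
      hΨτ hhalf₃ hδ₂ hT le_rfl hcl hv0 hEv t ht x⟩

end Main

end Summit.NavierStokesRegularity.FluidComputer.PalasekTowerClayBridge.StrainShadowHybrid

end
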